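import Summits.AnomalousDissipation.AnomalousDissipation.Theorems.SolenoidalFractalHomogenisationRealisedQuasiStaticCellLawSlavedSlotIn
import HarnessLib

/-!
# K2R `RealisedQuasiStaticCellLaw`, line `floquet-bloch`, stub `stub_upperSome`: the two gauged scalar ladders of a full
# slot along the Galerkin truncation, PACKAGED (out-of-plane and in-plane)

Summits-side helper file (everything proved; no definitions, no named facts; `--supports stmt-AnomalousDissipation-20446`).
The S1D files `…SlavedSlotOut` / `…SlavedSlotIn` rebuild, inside each slot theorem, the same scaffolding: over the full slot
`[pP + start j, pP + start j + τ_j]` the gauged out-of-plane components `μ_j^{−J}⟪ζ, α_N(k₀ + J•K_j)⟫` and in-plane components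
`μ_j^{−J}⟪p_J, α_N(k₀ + J•K_j)⟫` solve scalar three-term ladders of the shape consumed by the abstract ladder lemmas
(`v_J' = −Λ(d_J v_J + g(t)(s_{J−1}v_{J−1} − s_Jv_{J+1}))`, `g = g₁·trapezoid`, support in the resolved segment, the dead
right end of the last slot included). This file exports that scaffolding ONCE as two existential packages
(`outOfPlane_slot_ladder`, `inPlane_slot_ladder`), so that the LOWER-law, cone and drift lemmas of the `stub_upperSome` lane
apply to the cell problem by a one-line instantiation. No new mathematics.
-/

set_option linter.dupNamespace false -- layout D-0017: `AnomalousDissipation.AnomalousDissipation` repeats by design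

noncomputable section

namespace Summit.AnomalousDissipation.AnomalousDissipation.Theorems.SolenoidalFractalHomogenisation.RealisedQuasiStaticCellLaw

open Set MeasureTheory Filter Topology Function Complex Matrix
open scoped InnerProductSpace ComplexConjugate Matrix
open Literature.Analysis Literature.Analysis.FunctionSpaces Literature.Analysis.FunctionSpaces.Torus
open Literature.Analysis.FluidPDE Literature.Analysis.FluidPDE.LatticeShear
open Literature.Analysis.ODE.ThreeTermLadder
open Summit.AnomalousDissipation.AnomalousDissipation.Theorems.SolenoidalFractalHomogenisation.PermissibleCarrier

variable {k₀ : ℕ}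

/-- **The gauged out-of-plane ladder of a full slot, packaged.** Slot `j` of the `p`-th period, window
`[a, a + τ_j]`, `a = pP + start j`, inside `[0, T]`; coset `k_J = k₀ + J•K_j`, `ζ ⊥ k₀, K_j`, index segment `Wset` of the
resolved modes. Then there are a coupling function `g` and gauged components `v : ℝ → ℤ → ℂ` with: `g = g₁·trapezoid 0 τ_j ρ (· − a)`
on the slot (`g₁ = 2π(ê_j·k₀)|a_j|/(nΛ)`, `Λ = κ4π²|K_j|²`), `v` vanishes off `Wset`, `v` solves the three-term ladder
`v_J' = −Λ(d_J v_J + g(t)(v_{J−1} − v_{J+1}))`, `d_J = |k_J|²/|K_j|²`, within the slot (interior from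
`hasDerivWithinAt_gauged_outOfPlane`, dead right end from `hasDerivWithinAt_inner_galerkinCoeffAt_dead`), and
`‖v_J(t)‖ = ‖⟪ζ, α_N(t)(k_J)⟫‖`, `v_0(t) = ⟪ζ, α_N(t)(k₀)⟫` (the scaffolding of `outOfPlane_slot_contraction`, exported once
so that every abstract ladder lemma applies to the cell problem without repeating it). -/
theorem outOfPlane_slot_ladder (W : LatticeWord k₀) {n : ℕ} (hn : 0 < n) {κ : ℝ} (hκ : 0 < κ)
    (ℓ : Fin 3 → ℤ) {w₀ : UnitAddTorus (Fin 3) → EuclideanSpace ℝ (Fin 3)}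
    (hw₀ : FunctionSpaces.Torus.MemSobolev 1 (FunctionSpaces.EuclideanSpace.complexify ∘ w₀))
    (hdiv : FunctionSpaces.Torus.IsWeaklyDivFree w₀) (hmean : FunctionSpaces.Torus.HasZeroMean w₀)
    (hsupp : ∀ k : Fin 3 → ℤ, ¬ ((∃ z : Fin 3 → ℤ, k = ℓ + (n:ℤ) • z) ∨ (∃ z : Fin 3 → ℤ, k = -ℓ + (n:ℤ) • z)) →
      UnitAddTorus.mFourierCoeff (FunctionSpaces.EuclideanSpace.complexify ∘ w₀) k = 0)
    {N : ℕ} (hBN : (Finset.univ.biUnion fun j : Fin k₀ =>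
        ({(fun i => (W.phase j).m i * n), -(fun i => (W.phase j).m i * n)} : Finset (Fin 3 → ℤ))) ⊆ freqBall N)
    {T : ℝ} (p : ℕ) (j : Fin k₀) (hT : (p : ℝ) * W.period + W.start j + (W.phase j).τ ≤ T)
    (k0 : Fin 3 → ℤ) {ζ : EuclideanSpace ℂ (Fin 3)} (hζ₀ : ∑ i, (k0 i : ℂ) * ζ i = 0)
    (hζK : ∑ i, (((fun i => (W.phase j).m i * (n : ℤ)) i : ℤ) : ℂ) * ζ i = 0)
    {Wset : Finset ℤ} (hW : ∀ J : ℤ, J ∈ Wset ↔ k0 + J • (fun i => (W.phase j).m i * (n : ℤ)) ∈ freqBall N)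
    (Λ g₁ : ℝ) (hΛ : Λ = κ * (4 * Real.pi ^ 2 * freqNormSq (fun i => (W.phase j).m i * (n : ℤ))))
    (hg₁ : g₁ = 2 * Real.pi * (∑ i, (W.phase j).e i * (k0 i : ℝ)) *
        ‖Complex.exp ((W.phase j).φ * Complex.I) *
          (1 / (2 * ((2 * Real.pi * ‖latticeVec (W.phase j).m‖ : ℝ) : ℂ) * Complex.I))‖ * (1 / (n : ℝ)) / Λ) :
    ∃ g : ℝ → ℝ, ∃ v : ℝ → ℤ → ℂ,
      (∀ t ∈ Icc ((p : ℝ) * W.period + W.start j) ((p : ℝ) * W.period + W.start j + (W.phase j).τ),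
        g t = g₁ * LatticeWord.trapezoid 0 (W.phase j).τ W.ramp (t - ((p : ℝ) * W.period + W.start j))) ∧
      (∀ t ∈ Icc ((p : ℝ) * W.period + W.start j) ((p : ℝ) * W.period + W.start j + (W.phase j).τ),
        ∀ J, J ∉ Wset → v t J = 0) ∧
      (∀ t ∈ Icc ((p : ℝ) * W.period + W.start j) ((p : ℝ) * W.period + W.start j + (W.phase j).τ), ∀ J ∈ Wset,
        HasDerivWithinAt (fun t' => v t' J)
          (-(Λ : ℂ) * ((((fun J : ℤ => freqNormSq (k0 + J • (fun i => (W.phase j).m i * (n : ℤ))) /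
              freqNormSq (fun i => (W.phase j).m i * (n : ℤ))) J : ℝ) : ℂ) * v t J) -
            (g t : ℂ) * (Λ : ℂ) * ((((fun _ : ℤ => (1 : ℝ)) (J - 1) : ℝ) : ℂ) * v t (J - 1) -
              (((fun _ : ℤ => (1 : ℝ)) J : ℝ) : ℂ) * v t (J + 1)))
          (Icc ((p : ℝ) * W.period + W.start j) ((p : ℝ) * W.period + W.start j + (W.phase j).τ)) t) ∧
      (∀ t J, ‖v t J‖ = ‖inner ℂ ζ ((pvSetup_cell W hn hκ.le ℓ hw₀ hdiv hmean hsupp).galerkinCoeffAt N t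
        (k0 + J • (fun i => (W.phase j).m i * (n : ℤ))))‖) ∧
      (∀ t, v t 0 = inner ℂ ζ ((pvSetup_cell W hn hκ.le ℓ hw₀ hdiv hmean hsupp).galerkinCoeffAt N t k0)) := by
  classical
  set hPV := pvSetup_cell W hn hκ.le ℓ hw₀ hdiv hmean hsupp with hPVdef
  set K : Fin 3 → ℤ := fun i => (W.phase j).m i * (n : ℤ) with hK
  set A : ℂ := Complex.exp ((W.phase j).φ * Complex.I) *
      (1 / (2 * ((2 * Real.pi * ‖latticeVec (W.phase j).m‖ : ℝ) : ℂ) * Complex.I)) with hA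
  have hA0 : A ≠ 0 := layerAmp_ne_zero (W.phase j)
  set a : ℝ := (p : ℝ) * W.period + W.start j with ha
  set τ : ℝ := (W.phase j).τ with hτdef
  have hτ : 0 < τ := (W.phase j).τ_pos
  have hP : 0 < W.period := period_pos W
  have ha0 : 0 ≤ a := by
    have := start_nonneg W j; rw [ha]; positivity
  have haτP : a + τ ≤ (p + 1 : ℝ) * W.period := by
    have := start_add_tau_le_period W j; rw [ha, hτdef]; linarith
  -- the gauged components, the coupling function, the diagonal
  set v : ℝ → ℤ → ℂ := fun t J => (Complex.I * A / (‖A‖ : ℂ)) ^ (-J) * inner ℂ ζ (hPV.galerkinCoeffAt N t (k0 + J • K))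
    with hv
  set g : ℝ → ℝ := fun t => 2 * Real.pi * (∑ i, (W.phase j).e i * (k0 i : ℝ)) * ‖A‖ *
      ((1 / (n : ℝ)) * LatticeWord.trapezoid (W.start j) (W.phase j).τ W.ramp (Int.fract (t / W.period) * W.period)) /
    (κ * (4 * Real.pi ^ 2 * freqNormSq K)) with hgdef
  set d : ℤ → ℝ := fun J => freqNormSq (k0 + J • K) / freqNormSq K with hddef
  have hK0 : K ≠ 0 := cellFreq_ne_zero (W.phase j) hn
  have hKpos : 0 < freqNormSq K := by
    obtain ⟨i, hi⟩ : ∃ i, K i ≠ 0 := by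
      by_contra h
      push Not at h
      exact hK0 (funext h)
    have hi' : (K i : ℝ) ≠ 0 := by exact_mod_cast hi
    unfold freqNormSq
    exact lt_of_lt_of_le (by positivity) (Finset.single_le_sum (fun l _ => sq_nonneg ((K l : ℝ))) (Finset.mem_univ i))
  have hΛpos : 0 < Λ := by rw [hΛ]; positivity
  -- vanishing off the segment
  have hvsupp : ∀ t ∈ Icc a (a + τ), ∀ J, J ∉ Wset → v t J = 0 := by
    intro t _ J hJ
    have hnot : k0 + J • K ∉ freqBall N := fun h => hJ ((hW J).2 h)
    simp only [hv]
    rw [Torus.PVSetup.galerkinCoeffAt, coeffExt_of_not_mem _ hnot, inner_zero_right, mul_zero]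
  -- the replayed phase on the slot: `fract(t/P)·P = t - pP` before the period's end
  have hphase : ∀ t ∈ Icc a (a + τ), t < (p + 1 : ℝ) * W.period →
      Int.fract (t / W.period) * W.period = t - p * W.period := by
    intro t ht htP
    have e : t = (p : ℤ) * W.period + (t - p * W.period) := by push_cast; ring
    rw [e, fract_period_mul hP (p : ℤ) (by rw [ha] at ht; linarith [ht.1, start_nonneg W j]) (by linarith)]
    push_cast; ring
  -- the coupling in the trapezoid form
  have hgdef' : ∀ t ∈ Icc a (a + τ), g t = g₁ * LatticeWord.trapezoid 0 τ W.ramp (t - a) := by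
    intro t ht
    by_cases htP : t < (p + 1 : ℝ) * W.period
    · simp only [hgdef]
      rw [hphase t ht htP, trapezoid_shift, hg₁, hΛ, ha, hτdef]
      have e : t - p * W.period - W.start j = t - (p * W.period + W.start j) := by ring
      rw [e]; ring
    · -- the dead right end: both sides vanish
      have hteq : t = (p + 1 : ℝ) * W.period := le_antisymm (ht.2.trans haτP) (not_lt.1 htP)
      have hfr : Int.fract (t / W.period) * W.period = 0 := by
        rw [hteq, mul_div_assoc, div_self hP.ne', mul_one, show ((p : ℝ) + 1) = ((p + 1 : ℕ) : ℝ) by push_cast; ring,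
          Int.fract_natCast, zero_mul]
      have htrap0 : LatticeWord.trapezoid (W.start j) (W.phase j).τ W.ramp (Int.fract (t / W.period) * W.period) = 0 := by
        rw [hfr, trapezoid_shift, zero_sub]
        exact trapezoid_eq_zero_of_nonpos (W.phase j).τ_pos W.ramp_pos (neg_nonpos.2 (start_nonneg W j))
      have hta : t - a = τ := by
        have : a + τ = (p + 1 : ℝ) * W.period := le_antisymm haτP (hteq ▸ ht.2)
        linarith
      simp only [hgdef]
      rw [htrap0, hta, trapezoid_eq_of_mem_ramp_down hτ W.ramp_pos W.ramp_le
        ⟨by nlinarith [W.ramp_le, W.ramp_pos], le_rfl⟩]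
      simp
  -- the ladder on the full slot (interior and the dead right end)
  have hderiv : ∀ t ∈ Icc a (a + τ), ∀ J ∈ Wset, HasDerivWithinAt (fun t' => v t' J)
      (-(Λ : ℂ) * ((d J : ℂ) * v t J) -
        (g t : ℂ) * (Λ : ℂ) * ((((fun _ : ℤ => (1 : ℝ)) (J - 1) : ℝ) : ℂ) * v t (J - 1) -
          (((fun _ : ℤ => (1 : ℝ)) J : ℝ) : ℂ) * v t (J + 1))) (Icc a (a + τ)) t := by
    intro t ht J hJ
    have htT : t ∈ Icc 0 T := ⟨ha0.trans ht.1, ht.2.trans (by rw [ha, hτdef]; exact hT)⟩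
    have hsub : Icc a (a + τ) ⊆ Icc 0 T := Icc_subset_Icc ha0 (by rw [ha, hτdef]; exact hT)
    by_cases htP : t < (p + 1 : ℝ) * W.period
    · have hrt : Int.fract (t / W.period) * W.period ∈ Icc (W.start j) (W.start j + (W.phase j).τ) := by
        rw [hphase t ht htP]; rw [ha, hτdef] at ht; constructor <;> linarith [ht.1, ht.2]
      have h := hasDerivWithinAt_gauged_outOfPlane W hn hκ ℓ hw₀ hdiv hmean hsupp hBN htT j hrt k0 hζ₀ hζK J
        ((hW J).1 hJ)
      refine (h.mono hsub).congr_deriv ?_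
      simp only [hv, hgdef, hddef, hK, hA, hΛ]
      push_cast
      ring
    · -- dead right end
      have hteq : t = (p + 1 : ℝ) * W.period := le_antisymm (ht.2.trans haτP) (not_lt.1 htP)
      have hfr : Int.fract (t / W.period) * W.period = 0 := by
        rw [hteq, mul_div_assoc, div_self hP.ne', mul_one, show ((p : ℝ) + 1) = ((p + 1 : ℕ) : ℝ) by push_cast; ring,
          Int.fract_natCast, zero_mul]
      have hg0 : g t = 0 := by
        simp only [hgdef]
        rw [hfr, trapezoid_shift, zero_sub,
          trapezoid_eq_zero_of_nonpos (W.phase j).τ_pos W.ramp_pos (neg_nonpos.2 (start_nonneg W j))]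
        simp
      have h := hasDerivWithinAt_inner_galerkinCoeffAt_dead W hn hκ.le ℓ hw₀ hdiv hmean hsupp hBN htT hfr (k0 + J • K)
        ((hW J).1 hJ) ζ
      have h2 := (h.const_mul ((Complex.I * A / (‖A‖ : ℂ)) ^ (-J))).mono hsub
      refine h2.congr_deriv ?_
      rw [hg0]
      simp only [hv, hddef, hΛ]
      have hKc : ((freqNormSq K : ℝ) : ℂ) ≠ 0 := by exact_mod_cast hKpos.ne'
      push_cast
      field_simp
      ring
  refine ⟨g, v, hgdef', hvsupp, ?_, fun t J => ?_, fun t => ?_⟩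
  · intro t ht J hJ
    have h := hderiv t ht J hJ
    simpa only [hddef] using h
  · simp only [hv]; rw [norm_gauge_zpow_mul hA0]
  · simp only [hv, zero_smul, add_zero, neg_zero, zpow_zero, one_mul]

/-- **The gauged in-plane ladder of a full slot, packaged.** Companion of `outOfPlane_slot_ladder` for the in-plane
components `u_J = ⟪p_J, α_N(·)(k_J)⟫` (`p_J = |k_J|⁻¹ k_J × ζ`, `ζ` a real unit normal of `span(k₀, K_j)`, no zero frequency
on the resolved coset): links = Leray cosines `s_J = p_J·p_{J+1}`; the gauged `v` solves
`v_J' = −Λ(d_J v_J + g(t)(s_{J−1} v_{J−1} − s_J v_{J+1}))` within the slot, vanishes off `Wset`, and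
`‖v_J(t)‖ = ‖⟪p_J, α_N(t)(k_J)⟫‖`, `v_0(t) = ⟪p_0, α_N(t)(k₀)⟫` (the scaffolding of `inPlane_slot_contraction`, exported). -/
theorem inPlane_slot_ladder (W : LatticeWord k₀) {n : ℕ} (hn : 0 < n) {κ : ℝ} (hκ : 0 < κ)
    (ℓ : Fin 3 → ℤ) {w₀ : UnitAddTorus (Fin 3) → EuclideanSpace ℝ (Fin 3)}
    (hw₀ : FunctionSpaces.Torus.MemSobolev 1 (FunctionSpaces.EuclideanSpace.complexify ∘ w₀))
    (hdiv : FunctionSpaces.Torus.IsWeaklyDivFree w₀) (hmean : FunctionSpaces.Torus.HasZeroMean w₀)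
    (hsupp : ∀ k : Fin 3 → ℤ, ¬ ((∃ z : Fin 3 → ℤ, k = ℓ + (n:ℤ) • z) ∨ (∃ z : Fin 3 → ℤ, k = -ℓ + (n:ℤ) • z)) →
      UnitAddTorus.mFourierCoeff (FunctionSpaces.EuclideanSpace.complexify ∘ w₀) k = 0)
    {N : ℕ} (hBN : (Finset.univ.biUnion fun j : Fin k₀ =>
        ({(fun i => (W.phase j).m i * n), -(fun i => (W.phase j).m i * n)} : Finset (Fin 3 → ℤ))) ⊆ freqBall N)
    {T : ℝ} (p : ℕ) (j : Fin k₀) (hT : (p : ℝ) * W.period + W.start j + (W.phase j).τ ≤ T)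
    (k0 : Fin 3 → ℤ) (hk : ∀ J : ℤ, k0 + J • (fun i => (W.phase j).m i * (n : ℤ)) ∈ freqBall N →
      k0 + J • (fun i => (W.phase j).m i * (n : ℤ)) ≠ 0)
    {ζr : Fin 3 → ℝ} (hζ1 : ζr ⬝ᵥ ζr = 1) (hζ0 : ζr ⬝ᵥ (fun i => ((k0 i : ℤ) : ℝ)) = 0)
    (hζK : ζr ⬝ᵥ (fun i => (((fun i => (W.phase j).m i * (n : ℤ)) i : ℤ) : ℝ)) = 0)
    {pf : ℤ → Fin 3 → ℝ}
    (hp : ∀ J : ℤ, pf J = (Real.sqrt ((fun i => (((k0 + J • (fun i => (W.phase j).m i * (n : ℤ))) i : ℤ) : ℝ)) ⬝ᵥ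
        (fun i => (((k0 + J • (fun i => (W.phase j).m i * (n : ℤ))) i : ℤ) : ℝ))))⁻¹ •
        (fun i => (((k0 + J • (fun i => (W.phase j).m i * (n : ℤ))) i : ℤ) : ℝ)) ⨯₃ ζr)
    {Wset : Finset ℤ} (hW : ∀ J : ℤ, J ∈ Wset ↔ k0 + J • (fun i => (W.phase j).m i * (n : ℤ)) ∈ freqBall N)
    (Λ g₁ : ℝ) (hΛ : Λ = κ * (4 * Real.pi ^ 2 * freqNormSq (fun i => (W.phase j).m i * (n : ℤ))))
    (hg₁ : g₁ = 2 * Real.pi * (∑ i, (W.phase j).e i * (k0 i : ℝ)) *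
        ‖Complex.exp ((W.phase j).φ * Complex.I) *
          (1 / (2 * ((2 * Real.pi * ‖latticeVec (W.phase j).m‖ : ℝ) : ℂ) * Complex.I))‖ * (1 / (n : ℝ)) / Λ) :
    ∃ g : ℝ → ℝ, ∃ v : ℝ → ℤ → ℂ,
      (∀ t ∈ Icc ((p : ℝ) * W.period + W.start j) ((p : ℝ) * W.period + W.start j + (W.phase j).τ),
        g t = g₁ * LatticeWord.trapezoid 0 (W.phase j).τ W.ramp (t - ((p : ℝ) * W.period + W.start j))) ∧
      (∀ t ∈ Icc ((p : ℝ) * W.period + W.start j) ((p : ℝ) * W.period + W.start j + (W.phase j).τ),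
        ∀ J, J ∉ Wset → v t J = 0) ∧
      (∀ t ∈ Icc ((p : ℝ) * W.period + W.start j) ((p : ℝ) * W.period + W.start j + (W.phase j).τ), ∀ J ∈ Wset,
        HasDerivWithinAt (fun t' => v t' J)
          (-(Λ : ℂ) * ((((fun J : ℤ => freqNormSq (k0 + J • (fun i => (W.phase j).m i * (n : ℤ))) /
              freqNormSq (fun i => (W.phase j).m i * (n : ℤ))) J : ℝ) : ℂ) * v t J) -
            (g t : ℂ) * (Λ : ℂ) * ((((fun J : ℤ => pf J ⬝ᵥ pf (J + 1)) (J - 1) : ℝ) : ℂ) * v t (J - 1) -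
              (((fun J : ℤ => pf J ⬝ᵥ pf (J + 1)) J : ℝ) : ℂ) * v t (J + 1)))
          (Icc ((p : ℝ) * W.period + W.start j) ((p : ℝ) * W.period + W.start j + (W.phase j).τ)) t) ∧
      (∀ t J, ‖v t J‖ = ‖inner ℂ (WithLp.toLp 2 (Complex.ofReal ∘ pf J) : EuclideanSpace ℂ (Fin 3))
        ((pvSetup_cell W hn hκ.le ℓ hw₀ hdiv hmean hsupp).galerkinCoeffAt N t
          (k0 + J • (fun i => (W.phase j).m i * (n : ℤ))))‖) ∧
      (∀ t, v t 0 = inner ℂ (WithLp.toLp 2 (Complex.ofReal ∘ pf 0) : EuclideanSpace ℂ (Fin 3))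
        ((pvSetup_cell W hn hκ.le ℓ hw₀ hdiv hmean hsupp).galerkinCoeffAt N t k0)) := by
  classical
  set hPV := pvSetup_cell W hn hκ.le ℓ hw₀ hdiv hmean hsupp with hPVdef
  set K : Fin 3 → ℤ := fun i => (W.phase j).m i * (n : ℤ) with hK
  set A : ℂ := Complex.exp ((W.phase j).φ * Complex.I) *
      (1 / (2 * ((2 * Real.pi * ‖latticeVec (W.phase j).m‖ : ℝ) : ℂ) * Complex.I)) with hA
  have hA0 : A ≠ 0 := layerAmp_ne_zero (W.phase j)
  set pc : ℤ → EuclideanSpace ℂ (Fin 3) := fun J => WithLp.toLp 2 (Complex.ofReal ∘ pf J) with hpc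
  set a : ℝ := (p : ℝ) * W.period + W.start j with ha
  set τ : ℝ := (W.phase j).τ with hτdef
  have hτ : 0 < τ := (W.phase j).τ_pos
  have hP : 0 < W.period := period_pos W
  have ha0 : 0 ≤ a := by
    have := start_nonneg W j; rw [ha]; positivity
  have haτP : a + τ ≤ (p + 1 : ℝ) * W.period := by
    have := start_add_tau_le_period W j; rw [ha, hτdef]; linarith
  -- the raw and the gauged components, the links, the coupling function, the diagonal
  set u : ℝ → ℤ → ℂ := fun t J => inner ℂ (pc J) (hPV.galerkinCoeffAt N t (k0 + J • K)) with hu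
  set v : ℝ → ℤ → ℂ := fun t J => (Complex.I * A / (‖A‖ : ℂ)) ^ (-J) * u t J with hv
  set s : ℤ → ℝ := fun J => pf J ⬝ᵥ pf (J + 1) with hsdef
  set g : ℝ → ℝ := fun t => 2 * Real.pi * (∑ i, (W.phase j).e i * (k0 i : ℝ)) * ‖A‖ *
      ((1 / (n : ℝ)) * LatticeWord.trapezoid (W.start j) (W.phase j).τ W.ramp (Int.fract (t / W.period) * W.period)) /
    (κ * (4 * Real.pi ^ 2 * freqNormSq K)) with hgdef
  set d : ℤ → ℝ := fun J => freqNormSq (k0 + J • K) / freqNormSq K with hddef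
  have hK0 : K ≠ 0 := cellFreq_ne_zero (W.phase j) hn
  have hKpos : 0 < freqNormSq K := by
    obtain ⟨i, hi⟩ : ∃ i, K i ≠ 0 := by
      by_contra h
      push Not at h
      exact hK0 (funext h)
    have hi' : (K i : ℝ) ≠ 0 := by exact_mod_cast hi
    unfold freqNormSq
    exact lt_of_lt_of_le (by positivity) (Finset.single_le_sum (fun l _ => sq_nonneg ((K l : ℝ))) (Finset.mem_univ i))
  have hΛpos : 0 < Λ := by rw [hΛ]; positivity
  -- vanishing off the segment
  have hvsupp : ∀ t ∈ Icc a (a + τ), ∀ J, J ∉ Wset → v t J = 0 := by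
    intro t _ J hJ
    have hnot : k0 + J • K ∉ freqBall N := fun h => hJ ((hW J).2 h)
    simp only [hv, hu]
    rw [Torus.PVSetup.galerkinCoeffAt, coeffExt_of_not_mem _ hnot, inner_zero_right, mul_zero]
  -- the coupling scalar is real
  have hθ : ∑ i, (EuclideanSpace.complexify (W.phase j).e) i * (k0 i : ℂ) =
      ((∑ i, (W.phase j).e i * (k0 i : ℝ) : ℝ) : ℂ) := by
    push_cast
    refine Finset.sum_congr rfl fun i _ => ?_
    rw [EuclideanSpace.complexify_apply]
  -- the replayed phase on the slot
  have hphase : ∀ t ∈ Icc a (a + τ), t < (p + 1 : ℝ) * W.period →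
      Int.fract (t / W.period) * W.period = t - p * W.period := by
    intro t ht htP
    have e : t = (p : ℤ) * W.period + (t - p * W.period) := by push_cast; ring
    rw [e, fract_period_mul hP (p : ℤ) (by rw [ha] at ht; linarith [ht.1, start_nonneg W j]) (by linarith)]
    push_cast; ring
  -- the coupling in the trapezoid form
  have hgdef' : ∀ t ∈ Icc a (a + τ), g t = g₁ * LatticeWord.trapezoid 0 τ W.ramp (t - a) := by
    intro t ht
    by_cases htP : t < (p + 1 : ℝ) * W.period
    · simp only [hgdef]
      rw [hphase t ht htP, trapezoid_shift, hg₁, hΛ, ha, hτdef]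
      have e : t - p * W.period - W.start j = t - (p * W.period + W.start j) := by ring
      rw [e]; ring
    · have hteq : t = (p + 1 : ℝ) * W.period := le_antisymm (ht.2.trans haτP) (not_lt.1 htP)
      have hfr : Int.fract (t / W.period) * W.period = 0 := by
        rw [hteq, mul_div_assoc, div_self hP.ne', mul_one, show ((p : ℝ) + 1) = ((p + 1 : ℕ) : ℝ) by push_cast; ring,
          Int.fract_natCast, zero_mul]
      have htrap0 : LatticeWord.trapezoid (W.start j) (W.phase j).τ W.ramp (Int.fract (t / W.period) * W.period) = 0 := by
        rw [hfr, trapezoid_shift, zero_sub]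
        exact trapezoid_eq_zero_of_nonpos (W.phase j).τ_pos W.ramp_pos (neg_nonpos.2 (start_nonneg W j))
      have hta : t - a = τ := by
        have : a + τ = (p + 1 : ℝ) * W.period := le_antisymm haτP (hteq ▸ ht.2)
        linarith
      simp only [hgdef]
      rw [htrap0, hta, trapezoid_eq_of_mem_ramp_down hτ W.ramp_pos W.ramp_le
        ⟨by nlinarith [W.ramp_le, W.ramp_pos], le_rfl⟩]
      simp
  -- the gauged ladder on the full slot
  have hderiv : ∀ t ∈ Icc a (a + τ), ∀ J ∈ Wset, HasDerivWithinAt (fun t' => v t' J)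
      (-(Λ : ℂ) * ((d J : ℂ) * v t J) -
        (g t : ℂ) * (Λ : ℂ) * ((s (J - 1) : ℂ) * v t (J - 1) - (s J : ℂ) * v t (J + 1))) (Icc a (a + τ)) t := by
    intro t ht J hJ
    have htT : t ∈ Icc 0 T := ⟨ha0.trans ht.1, ht.2.trans (by rw [ha, hτdef]; exact hT)⟩
    have hsub : Icc a (a + τ) ⊆ Icc 0 T := Icc_subset_Icc ha0 (by rw [ha, hτdef]; exact hT)
    by_cases htP : t < (p + 1 : ℝ) * W.period
    · have hrt : Int.fract (t / W.period) * W.period ∈ Icc (W.start j) (W.start j + (W.phase j).τ) := by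
        rw [hphase t ht htP]; rw [ha, hτdef] at ht; constructor <;> linarith [ht.1, ht.2]
      have h1' := hasDerivWithinAt_inPlane_slot W hn hκ.le ℓ hw₀ hdiv hmean hsupp hBN htT j hrt k0 hk hζ1 hζ0 hζK hp
        J ((hW J).1 hJ)
      set c : ℝ := (1 / (n : ℝ)) * LatticeWord.trapezoid (W.start j) (W.phase j).τ W.ramp
        (Int.fract (t / W.period) * W.period) with hc
      set r : ℂ := ((2 * Real.pi * (∑ i, (W.phase j).e i * (k0 i : ℝ)) * c : ℝ) : ℂ) with hr
      have h2 : HasDerivWithinAt (fun t' => u t' J)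
          (-(((κ * (4 * Real.pi ^ 2 * freqNormSq (k0 + J • K))) : ℝ) : ℂ) * u t J -
            (r * Complex.I) * (A * (((pf J ⬝ᵥ pf (J - 1) : ℝ) : ℂ) * u t (J - 1)) +
              conj A * (((pf J ⬝ᵥ pf (J + 1) : ℝ) : ℂ) * u t (J + 1)))) (Icc 0 T) t := by
        refine h1'.congr_deriv ?_
        rw [hθ, layerAmp_conj (W.phase j)]
        simp only [hu, hpc, hA, hr, hK]
        push_cast
        ring
      have h3 := (h2.const_mul ((Complex.I * A / (‖A‖ : ℂ)) ^ (-J))).mono hsub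
      refine h3.congr_deriv ?_
      rw [gauge_rhs hA0]
      have hKc : ((freqNormSq K : ℝ) : ℂ) ≠ 0 := by exact_mod_cast hKpos.ne'
      have hκc : ((κ : ℝ) : ℂ) ≠ 0 := by exact_mod_cast hκ.ne'
      have hπc : ((Real.pi : ℝ) : ℂ) ≠ 0 := by exact_mod_cast Real.pi_pos.ne'
      have hs1 : s (J - 1) = pf J ⬝ᵥ pf (J - 1) := by
        simp only [hsdef, sub_add_cancel]; exact dotProduct_comm _ _
      have hs2 : s J = pf J ⬝ᵥ pf (J + 1) := rfl
      rw [hs1, hs2]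
      simp only [hv, hgdef, hddef, hr, hc, hΛ]
      generalize (Complex.I * A / (‖A‖ : ℂ)) ^ (-J) = μ₁
      generalize (Complex.I * A / (‖A‖ : ℂ)) ^ (-(J - 1)) = μ₂
      generalize (Complex.I * A / (‖A‖ : ℂ)) ^ (-(J + 1)) = μ₃
      generalize (‖A‖ : ℝ) = nA
      push_cast
      field_simp
    · -- dead right end
      have hteq : t = (p + 1 : ℝ) * W.period := le_antisymm (ht.2.trans haτP) (not_lt.1 htP)
      have hfr : Int.fract (t / W.period) * W.period = 0 := by
        rw [hteq, mul_div_assoc, div_self hP.ne', mul_one, show ((p : ℝ) + 1) = ((p + 1 : ℕ) : ℝ) by push_cast; ring,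
          Int.fract_natCast, zero_mul]
      have hg0 : g t = 0 := by
        simp only [hgdef]
        rw [hfr, trapezoid_shift, zero_sub,
          trapezoid_eq_zero_of_nonpos (W.phase j).τ_pos W.ramp_pos (neg_nonpos.2 (start_nonneg W j))]
        simp
      have h := hasDerivWithinAt_inner_galerkinCoeffAt_dead W hn hκ.le ℓ hw₀ hdiv hmean hsupp hBN htT hfr (k0 + J • K)
        ((hW J).1 hJ) (pc J)
      have h2 := (h.const_mul ((Complex.I * A / (‖A‖ : ℂ)) ^ (-J))).mono hsub
      refine h2.congr_deriv ?_
      rw [hg0]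
      simp only [hv, hu, hddef, hΛ]
      have hKc : ((freqNormSq K : ℝ) : ℂ) ≠ 0 := by exact_mod_cast hKpos.ne'
      push_cast
      field_simp
      ring
  refine ⟨g, v, hgdef', hvsupp, ?_, fun t J => ?_, fun t => ?_⟩
  · intro t ht J hJ
    have h := hderiv t ht J hJ
    simpa only [hddef, hsdef] using h
  · simp only [hv, hu]; rw [norm_gauge_zpow_mul hA0]
  · simp only [hv, hu, hpc, zero_smul, add_zero, neg_zero, zpow_zero, one_mul]

end Summit.AnomalousDissipation.AnomalousDissipation.Theorems.SolenoidalFractalHomogenisation.RealisedQuasiStaticCellLaw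

end
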